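import Mathlib
import HarnessLib
import Literature.Probability.MarkovChains.DataAugmentationAutocovarianceLogConvex
import Literature.Probability.MarkovChains.RandomScanGibbsAsDataAugmentation

/-!
# Autocorrelations of the random-scan Gibbs sampler are log-convex, `τ_int ≥ (1 + ρ₁)/(1 − ρ₁)`, and for a coordinate-Lipschitz observable `τ_int ≥ 4 var(h)/δ² − 1` (Liu 2001 §13.2.2 with §12.6; Berg 2004 §4.1)

HONEST FRAMING: exact (Metropolis-corrected) sampling algorithms for lattice gauge theory; figures
of merit are autocorrelation/cost numbers at stated couplings and volumes; no continuum-physics claim.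

This file ASSEMBLES `RandomScanGibbsAsDataAugmentation.lean` (Liu 2001 §13.2.2: the random-scan Gibbs
sampler `P₁ = randomScanGibbs α π` IS the data-augmentation chain `daKernel (rsgsJoint α π)`) with
`DataAugmentationAutocovarianceLogConvex.lean` (autocovariances of a data-augmentation chain are
log-convex, `C_k ≥ C_0 ρ₁ᵏ`, `τ_int ≥ (1 + ρ₁)/(1 − ρ₁)`; sources: Liu 2001 §12.6 mixture-of-powers
display, Berg 2004 §4.1 (4.12)/(4.16)) and with the Dirichlet-form identity
`‖g‖²_π − ⟨g, P g⟩_π = ½ Σ π(x)P(x,y)(g(x) − g(y))²` of `PeskunOrdering.lean` (`dirichletForm_eq`,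
[AndrieuVihola2016, §3]).  Everything is PROVED (finite product spaces, `α > 0` a probability vector,
`π > 0` a probability vector); no definition, no named fact.

* **`rsgs_autocov_logConvex`** — `C_{k+1}(g)² ≤ C_k(g) C_{k+2}(g)`, `C_k(g) = ⟨g, P₁ᵏ g⟩_π`;
  `rsgs_autocov_ge_geometric` — `C_k ≥ C_0 ρ₁ᵏ`; **`rsgs_tauIntInf_ge`** — `τ_int ≥ (1 + ρ₁)/(1 − ρ₁)`;
* `randomScanGibbs_apply_eq_zero` — `P₁(x,y) = 0` unless `y` is a single-site modification of `x`;
  **`rsgs_piInner_sub_le`** — for an observable changing by at most `δ` under a single-site move,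
  `‖g‖²_π − ⟨g, P₁ g⟩_π ≤ δ²/2`, i.e. `1 − ρ₁ ≤ δ²/(2‖g‖²)`;
* **`rsgs_tauIntInf_ge_of_lipschitz`** — hence `τ_int ≥ 4‖ḡ‖²_π/δ² − 1` for such `g = ḡ`
  (`ḡ = h − E_π h`): a local (single-site) heat-bath dynamics needs at least of the order of
  `var_π(h)/δ²` single-site updates to decorrelate `h` — e.g. `τ_int ≥ var(M) − 1` for the magnetisation `M = Σσ_i`
  of `±1` spins (`δ = 2`).

NOT CLAIMED: systematic (deterministic-scan) sweeps (not positive operators); `τ_exp`; the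
infinite-volume statement `τ ≳ χ`.

Context (cell pub-lqcd, venture LatticeQCDFlow): the rigorous finite-volume form of "critical slowing
down of local heat-bath updates is at least the susceptibility", against which cluster / collective
updates are measured.
-/

namespace Literature.Probability.MarkovChains

open Finset Matrix Function

variable {d : ℕ} {S : Fin d → Type*} [∀ j, Fintype (S j)] [∀ j, DecidableEq (S j)]
  {π : (∀ j, S j) → ℝ} {α : Fin d → ℝ}

/-- The marginal of `rsgsJoint` on the state, as a function: `(y ↦ Σ_u J(y,u)) = π`.
[cite: Liu2001MonteCarlo, §13.2.2] -/
theorem sum_rsgsJoint_right_eq (hα1 : ∑ i, α i = 1) (hπ : ∀ x, 0 < π x) :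
    (fun y => ∑ u, rsgsJoint α π y u) = π :=
  funext (sum_rsgsJoint_right hα1 hπ)

/-- **Log-convexity of the autocovariances of the random-scan Gibbs sampler**:
`⟨g, P₁ᵏ⁺¹ g⟩² ≤ ⟨g, P₁ᵏ g⟩ ⟨g, P₁ᵏ⁺² g⟩`. [cite: Liu2001MonteCarlo, §13.2.2 (RSGS is interleaving /
data augmentation) with §12.6 (display `ρ_n(h) = Σ cᵢ²λᵢⁿ/Σ cᵢ²`)] -/
theorem rsgs_autocov_logConvex (hα : ∀ i, 0 < α i) (hα1 : ∑ i, α i = 1) (hπ : ∀ x, 0 < π x)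
    (k : ℕ) (g : (∀ j, S j) → ℝ) :
    piInner π g ((randomScanGibbs α π ^ (k + 1)) *ᵥ g) ^ 2
      ≤ piInner π g ((randomScanGibbs α π ^ k) *ᵥ g)
        * piInner π g ((randomScanGibbs α π ^ (k + 2)) *ᵥ g) := by
  have h := da_autocov_logConvex (J := rsgsJoint α π) (rsgsJoint_nonneg (fun i => (hα i).le) hπ)
    (fun y => by rw [sum_rsgsJoint_right hα1 hπ]; exact hπ y)
    (fun u => by rw [sum_rsgsJoint_left hπ]; exact mul_pos (hα _) (hπ _)) k g
  rwa [sum_rsgsJoint_right_eq hα1 hπ, Liu2001_randomScanGibbs_eq_daKernel hα hα1 hπ] at h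

/-- **`C_k ≥ C_0 ρ₁ᵏ`** for the random-scan Gibbs sampler (`ρ₁ = ⟨g,P₁g⟩/‖g‖²`, `‖g‖²_π > 0`).
[cite: Liu2001MonteCarlo, §13.2.2 with §12.6] -/
theorem rsgs_autocov_ge_geometric (hα : ∀ i, 0 < α i) (hα1 : ∑ i, α i = 1) (hπ : ∀ x, 0 < π x)
    (g : (∀ j, S j) → ℝ) (h0 : 0 < piInner π g g) (k : ℕ) :
    piInner π g g * (piInner π g (randomScanGibbs α π *ᵥ g) / piInner π g g) ^ k
      ≤ piInner π g ((randomScanGibbs α π ^ k) *ᵥ g) := by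
  have h := da_autocov_ge_geometric (J := rsgsJoint α π) (rsgsJoint_nonneg (fun i => (hα i).le) hπ)
    (fun y => by rw [sum_rsgsJoint_right hα1 hπ]; exact hπ y)
    (fun u => by rw [sum_rsgsJoint_left hπ]; exact mul_pos (hα _) (hπ _)) g
  rw [sum_rsgsJoint_right_eq hα1 hπ, Liu2001_randomScanGibbs_eq_daKernel hα hα1 hπ] at h
  exact h h0 k

/-- **`τ_int ≥ (1 + ρ₁)/(1 − ρ₁)`** for the random-scan Gibbs sampler and any observable with summable
autocorrelations (`ρ₁ < 1`). [cite: Berg2004, §4.1 eq. (4.12), (4.16); Liu2001MonteCarlo, §13.2.2 with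
§12.6] -/
theorem rsgs_tauIntInf_ge (hα : ∀ i, 0 < α i) (hα1 : ∑ i, α i = 1) (hπ : ∀ x, 0 < π x)
    (g : (∀ j, S j) → ℝ) (h0 : 0 < piInner π g g)
    (hr1 : piInner π g (randomScanGibbs α π *ᵥ g) < piInner π g g)
    (hs : Summable fun k => piInner π g ((randomScanGibbs α π ^ (k + 1)) *ᵥ g)
      / piInner π g ((randomScanGibbs α π ^ 0) *ᵥ g)) :
    (1 + piInner π g (randomScanGibbs α π *ᵥ g) / piInner π g g)
        / (1 - piInner π g (randomScanGibbs α π *ᵥ g) / piInner π g g)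
      ≤ tauIntInf (fun k => piInner π g ((randomScanGibbs α π ^ k) *ᵥ g)) := by
  have h := da_tauIntInf_ge (J := rsgsJoint α π) (rsgsJoint_nonneg (fun i => (hα i).le) hπ)
    (fun y => by rw [sum_rsgsJoint_right hα1 hπ]; exact hπ y)
    (fun u => by rw [sum_rsgsJoint_left hπ]; exact mul_pos (hα _) (hπ _)) g
  rw [sum_rsgsJoint_right_eq hα1 hπ, Liu2001_randomScanGibbs_eq_daKernel hα hα1 hπ] at h
  exact h h0 hr1 hs

/-! ## Local moves: a Lipschitz observable decorrelates slowly -/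

omit [∀ j, Fintype (S j)] in
/-- `P₁(x, y) = 0` unless `y = x^{i ← y_i}` for some coordinate `i` (single-site moves only).
[cite: Liu2001MonteCarlo, §13.3.2 proof of Thm 13.3.3 ("all the nonzero elements of the transition
matrix `P₁` … are of the form `α_i π(y_i | x_{[−i]})`, where `y = x` except that `y_i` replaces `x_i`")] -/
theorem randomScanGibbs_apply_eq_zero [∀ j, Fintype (S j)] (α : Fin d → ℝ) (π : (∀ j, S j) → ℝ)
    {x y : ∀ j, S j} (hxy : ∀ i, y ≠ update x i (y i)) : randomScanGibbs α π x y = 0 := by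
  rw [show randomScanGibbs α π x y
      = ∑ i, α i * (if y = update x i (y i) then fullConditional π i x (y i) else 0)
      from siteScan_apply α _ x y]
  exact sum_eq_zero fun i _ => by rw [if_neg (hxy i), mul_zero]

/-- **`‖g‖²_π − ⟨g, P₁ g⟩_π ≤ δ²/2`** for an observable with `|g(x^{i ← v}) − g(x)| ≤ δ` for all single-site
modifications (Dirichlet form `= ½ Σ π(x) P₁(x,y) (g(x) − g(y))²`, and `P₁` only makes single-site
moves): the lag-one autocorrelation of such `g` is at least `1 − δ²/(2‖g‖²_π)`. [cite:
AndrieuVihola2016, §3 (the Dirichlet form identity); Liu2001MonteCarlo, §13.3.2 proof of Thm 13.3.3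
(structure of `P₁`)] -/
theorem rsgs_piInner_sub_le (hα0 : ∀ i, 0 ≤ α i) (hα1 : ∑ i, α i = 1) (hπ : ∀ x, 0 < π x)
    (hπ1 : ∑ x, π x = 1) {g : (∀ j, S j) → ℝ} {δ : ℝ}
    (hg : ∀ (x : ∀ j, S j) (i : Fin d) (v : S i), |g (update x i v) - g x| ≤ δ) :
    piInner π g g - piInner π g (randomScanGibbs α π *ᵥ g) ≤ δ ^ 2 / 2 := by
  have hP := randomScanGibbs_isRowStochastic hα0 hα1 hπ
  have hst : IsStationary π (randomScanGibbs α π) :=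
    (randomScanGibbs_detailedBalance α π).isStationary hP.2
  rw [← dirichletForm_eq hP hst g]
  unfold dirichletForm
  -- each term: `π x P x y (g x − g y)² ≤ π x P x y δ²`
  have hterm : ∀ x y : ∀ j, S j, π x * randomScanGibbs α π x y * (g x - g y) ^ 2
      ≤ π x * randomScanGibbs α π x y * δ ^ 2 := by
    intro x y
    by_cases hxy : ∃ i, y = update x i (y i)
    · obtain ⟨i, hi⟩ := hxy
      refine mul_le_mul_of_nonneg_left ?_ (mul_nonneg (hπ x).le (hP.1 x y))
      have hδ : |g x - g y| ≤ δ := by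
        rw [abs_sub_comm, hi]; exact hg x i (y i)
      calc (g x - g y) ^ 2 = |g x - g y| ^ 2 := (sq_abs _).symm
        _ ≤ δ ^ 2 := pow_le_pow_left₀ (abs_nonneg _) hδ 2
    · simp only [not_exists] at hxy
      rw [randomScanGibbs_apply_eq_zero α π hxy]
      simp
  have hsum : ∑ x, ∑ y, π x * randomScanGibbs α π x y * (g x - g y) ^ 2 ≤ δ ^ 2 :=
    calc ∑ x, ∑ y, π x * randomScanGibbs α π x y * (g x - g y) ^ 2
        ≤ ∑ x, ∑ y, π x * randomScanGibbs α π x y * δ ^ 2 :=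
          sum_le_sum fun x _ => sum_le_sum fun y _ => hterm x y
      _ = δ ^ 2 := by
          simp_rw [← sum_mul, ← mul_sum, hP.2, mul_one, hπ1, one_mul]
  linarith

/-- **Local heat-bath dynamics decorrelates a Lipschitz observable slowly**: for the random-scan Gibbs
sampler and a `π`-mean-zero observable `g` (`‖g‖²_π > 0`, summable autocorrelations, `ρ₁ < 1`) with
`|g(x^{i ← v}) − g(x)| ≤ δ` (`δ > 0`), `τ_int ≥ 4‖g‖²_π/δ² − 1` (counted in single-site updates; e.g.
`≥ var(M) − 1` for the magnetisation of `±1` spins, `δ = 2`). [cite: Berg2004, §4.1 eq. (4.12), (4.16);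
Liu2001MonteCarlo, §13.2.2 with §12.6; AndrieuVihola2016, §3] -/
theorem rsgs_tauIntInf_ge_of_lipschitz (hα : ∀ i, 0 < α i) (hα1 : ∑ i, α i = 1) (hπ : ∀ x, 0 < π x)
    (hπ1 : ∑ x, π x = 1) (g : (∀ j, S j) → ℝ) (h0 : 0 < piInner π g g)
    (hr1 : piInner π g (randomScanGibbs α π *ᵥ g) < piInner π g g)
    (hs : Summable fun k => piInner π g ((randomScanGibbs α π ^ (k + 1)) *ᵥ g)
      / piInner π g ((randomScanGibbs α π ^ 0) *ᵥ g))
    {δ : ℝ} (hδ : 0 < δ) (hg : ∀ (x : ∀ j, S j) (i : Fin d) (v : S i), |g (update x i v) - g x| ≤ δ) :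
    4 * piInner π g g / δ ^ 2 - 1
      ≤ tauIntInf (fun k => piInner π g ((randomScanGibbs α π ^ k) *ᵥ g)) := by
  have hτ := rsgs_tauIntInf_ge hα hα1 hπ g h0 hr1 hs
  have hD := rsgs_piInner_sub_le (fun i => (hα i).le) hα1 hπ hπ1 (g := g) hg
  refine le_trans ?_ hτ
  -- `(1 + ρ)/(1 − ρ) = 2/(1 − ρ) − 1` and `1 − ρ ≤ δ²/(2‖g‖²)`
  set C0 := piInner π g g with hC0
  set C1 := piInner π g (randomScanGibbs α π *ᵥ g) with hC1
  have hgap : 0 < 1 - C1 / C0 := by rw [sub_pos, div_lt_one h0]; exact hr1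
  have hgap_le : 1 - C1 / C0 ≤ δ ^ 2 / (2 * C0) := by
    rw [show 1 - C1 / C0 = (C0 - C1) / C0 by field_simp, div_le_div_iff₀ h0 (by positivity)]
    nlinarith [hD, h0]
  have key : 4 * C0 / δ ^ 2 ≤ 2 / (1 - C1 / C0) := by
    rw [div_le_div_iff₀ (by positivity) hgap]
    have := mul_le_mul_of_nonneg_left hgap_le (by positivity : (0 : ℝ) ≤ 4 * C0)
    calc 4 * C0 * (1 - C1 / C0) ≤ 4 * C0 * (δ ^ 2 / (2 * C0)) := this
      _ = 2 * δ ^ 2 := by field_simp; ring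
  have e : (1 + C1 / C0) / (1 - C1 / C0) = 2 / (1 - C1 / C0) - 1 := by
    have hne : 1 - C1 / C0 ≠ 0 := hgap.ne'
    rw [eq_sub_iff_add_eq, div_add_one hne]
    congr 1
    ring
  rw [e]
  linarith

end Literature.Probability.MarkovChains
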